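import Summits.PneNP.PneNP.Theorems.ExpanderLinearGeneratorsLinearGeneratorModPFregeHardMod2RowWalk
import HarnessLib

/-!
# `MOD₂` summation, abstract level, IIb: the parity of one row from its canonical clauses

Support file for item `stmt-PneNP-11444` (`LinearGeneratorModPFregeHard`), calibration line "for
`p = 2` the rung fails".  Setting as in `…Mod2Xor.lean` / `…Mod2RowWalk.lean`: `MOD₂` subformulas
are atoms `var (zv c k κ)`, the `MOD₂` axioms are skeleton hypotheses whose negations lie in the
context `K`; the kind `κ` is one row with support `S ⊆ [0,n)` and right-hand side `b`, and `K`
contains the negation of every canonical clause of "`Σ_{k ∈ S} x_k = b`" (hypothesis `hKcl`).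

* `sq_row_leaves` — at full length, assignments of the right parity give `Z(b,n,κ)` (the walk of
  `…Mod2RowWalk.lean`), assignments of the wrong parity are closed by their clause;
* `sq_row_merge` — the `2^|S|` leaves are merged by cuts on the variables of `S` (decision tree);
* `sq_row` — the row fact `⊢ Z(b,n,κ), K` in `2^|S| · O(n)` ticks, polynomial in the size of the
  row's canonical CNF (`2^{|S|-1}` clauses).

No definitions are introduced.

Sources: S. Buss et al., Comput. Complexity 6 (1996/97), Def. 1.1 (`MOD_a` axioms); C. Beck,
*Time and Space in Proof Complexity* (2017), Def. 5.6 (the canonical CNF `sumEncoding`);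
folklore.
-/

set_option linter.dupNamespace false -- `Summit.PneNP.PneNP.…`: summit = sub-problem (D-0017)

namespace Summit.PneNP.PneNP.Theorems.ModTwo

open Literature.Computability.Complexity Literature.Computability.Complexity.PropForm
open Literature.Computability.MetaComplexity Literature.Computability.MetaComplexity.DepthFrege
open Literature.Computability.MetaComplexity.TextbookFrege (disjList disjList_nil disjList_cons)
open Literature.Computability.MetaComplexity.KEval (litForm clauseForm clauseForm_cons)

section Row

variable {Q : SPrm} (zv : ZMod 2 → ℕ → ℕ → ℕ) (Y : ℕ → ℕ → PropForm ℕ)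
  (H3 : ZMod 2 → ℕ → ℕ → PropForm ℕ) (κ : ℕ) (S : Finset ℕ) (n : ℕ) (K : List (PropForm ℕ))

/-! ### Leaves and the decision tree -/

/-- **Leaves.** At full length `n` (`S ⊆ [0,n)`), every total assignment `ρ` of `S` yields
`⊢ Z(b,n,κ), lits(ρ), K`: if `ρ` has parity `b` this is the walk; otherwise the clause of `ρ`
(whose negation is in `K`) closes the sequent. [Beck 2017, Def. 5.6] [folklore] -/
theorem sq_row_leaves
    (hH3₀ : ∀ k κ, H3 0 k κ = PropForm.biimp (var (zv 0 (k + 1) κ))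
      (disj (conj (var (zv 0 k κ)) (neg (Y k κ))) (conj (var (zv 1 k κ)) (Y k κ))))
    (hH3₁ : ∀ k κ, H3 1 k κ = PropForm.biimp (var (zv 1 (k + 1) κ))
      (disj (conj (var (zv 1 k κ)) (neg (Y k κ))) (conj (var (zv 0 k κ)) (Y k κ))))
    (hY : ∀ k κ, Y k κ = var k ∨ Y k κ = const false)
    (hYS : ∀ k, Y k κ = if k ∈ S then var k else const false)
    (hKb : ∀ A ∈ K, Base Q A) (hQ : 8 ≤ Q.D ∧ 40 ≤ Q.M)
    (hK3 : ∀ (c : ZMod 2) (k : ℕ), k < n → neg (H3 c k κ) ∈ K)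
    (hK1 : neg (var (zv 0 0 κ)) ∈ K)
    {N : ℕ} (hN : 1200 ≤ N) (hW : K.length + S.card + N + 10 ≤ Q.W)
    (hSn : ∀ v ∈ S, v < n) {b : ZMod 2}
    (hKcl : ∀ ρ : ℕ → Bool, ((((S.sort (· ≤ ·)).filter fun v => ρ v).length : ℕ) : ZMod 2) ≠ b →
      neg (clauseForm ((S.sort (· ≤ ·)).map fun v => (v, !ρ v))) ∈ K)
    (ρ : ℕ → Bool) :
    Sq Q ((2 ^ (N + 2) + 3) * (n + 1) + 2 * S.card + 2)
      (var (zv b n κ) :: ((S.sort (· ≤ ·)).map (fun v => litForm (v, !ρ v)) ++ K)) := by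
  have hSfull : S.filter (· < n) = S := Finset.filter_true_of_mem hSn
  by_cases hpar : ((((S.sort (· ≤ ·)).filter fun v => ρ v).length : ℕ) : ZMod 2) = b
  · have hw := sq_row_walk zv Y H3 κ S n K hH3₀ hH3₁ hY hYS hKb hQ hK3 hK1 hN hW n le_rfl ρ
    rw [hSfull, hpar] at hw
    exact hw.mono (by omega)
  · have hcl := hKcl ρ hpar
    have hL : ∀ A ∈ var (zv b n κ) :: ((S.sort (· ≤ ·)).map (fun v => litForm (v, !ρ v)) ++ K),
        Base Q A := by
      intro A hA
      rcases List.mem_cons.1 hA with rfl | hA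
      · exact base_of_bounds hQ (by simp [altDepth, altDepthAux]) (by simp [size])
      · rcases List.mem_append.1 hA with hA | hA
        · exact base_lits ρ _ A hA
        · exact hKb A hA
    have hlen : ((S.sort (· ≤ ·)).map (fun v => litForm (v, !ρ v))).length = S.card := by
      rw [List.length_map, Finset.length_sort]
    have h1 := sq_negClause (Q := Q) hL
      (by simp only [List.length_cons, List.length_append, hlen]; omega)
      ((S.sort (· ≤ ·)).map fun v => (v, !ρ v))
      (by
        intro l hl
        obtain ⟨v, hv, rfl⟩ := List.mem_map.1 hl
        exact List.mem_cons_of_mem _ (List.mem_append_left _ (List.mem_map.2 ⟨v, hv, rfl⟩)))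
      (hKb _ hcl)
    refine (h1.weaken ?_ hL ?_).mono ?_
    · intro A hA
      rcases List.mem_cons.1 hA with rfl | hA
      · exact List.mem_cons_of_mem _ (List.mem_append_right _ hcl)
      · exact hA
    · simp only [List.length_cons, List.length_append, hlen]; omega
    · simp only [List.length_map, Finset.length_sort]; omega

/-- **Decision tree.** If every total assignment `ρ` of the sorted list `S` gives
`⊢ z, lits(ρ), K` within `B` ticks, then `⊢ z, K` within `2^|S|·(B+3)` ticks: cut on the
variables of `S` from the last one down. [folklore] -/
theorem sq_row_merge {B z : ℕ} (hKb : ∀ A ∈ K, Base Q A) (hQ : 8 ≤ Q.D ∧ 40 ≤ Q.M)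
    (hW : K.length + S.card + 4 ≤ Q.W)
    (hleaf : ∀ ρ : ℕ → Bool,
      Sq Q B (var z :: ((S.sort (· ≤ ·)).map (fun v => litForm (v, !ρ v)) ++ K))) :
    ∀ (L₂ L₁ : List ℕ) (ρ : ℕ → Bool), S.sort (· ≤ ·) = L₁ ++ L₂ →
      Sq Q (2 ^ L₂.length * (B + 3) - 3) (var z :: (L₁.map (fun v => litForm (v, !ρ v)) ++ K))
  | [], L₁, ρ, hsplit => by
    rw [List.append_nil] at hsplit
    rw [← hsplit]
    exact (hleaf ρ).mono (by simp)
  | v :: L₂, L₁, ρ, hsplit => by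
    have hnd : (L₁ ++ v :: L₂).Nodup := hsplit ▸ Finset.sort_nodup _ _
    have hv : v ∉ L₁ := by
      intro hv
      rw [List.nodup_append] at hnd
      exact hnd.2.2 v hv v List.mem_cons_self rfl
    have hL₁ : L₁.length + 1 ≤ S.card := by
      have := congrArg List.length hsplit
      simp only [Finset.length_sort, List.length_append, List.length_cons] at this
      omega
    have hz : Base Q (var z) := base_of_bounds hQ (by simp [altDepth, altDepthAux]) (by simp [size])
    -- the two sons
    have son : ∀ c : Bool, Sq Q (2 ^ L₂.length * (B + 3) - 3 + 1)
        (litForm (v, !c) :: var z :: (L₁.map (fun w => litForm (w, !ρ w)) ++ K)) := by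
      intro c
      have h := sq_row_merge hKb hQ hW hleaf L₂ (L₁ ++ [v]) (Function.update ρ v c)
        (by rw [hsplit]; simp)
      have hmap : (L₁ ++ [v]).map (fun w => litForm (w, !(Function.update ρ v c w))) =
          L₁.map (fun w => litForm (w, !ρ w)) ++ [litForm (v, !c)] := by
        rw [List.map_append, List.map_singleton, Function.update_self]
        congr 1
        refine List.map_congr_left fun w hw => ?_
        rw [Function.update_of_ne (ne_of_mem_of_not_mem hw hv)]
      rw [hmap] at h
      refine h.weaken ?_ ?_ ?_
      · intro A hA
        simp only [List.mem_cons, List.mem_append] at hA ⊢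
        tauto
      · intro A hA
        simp only [List.mem_cons, List.mem_append] at hA
        rcases hA with rfl | rfl | hA | hA
        · exact base_litForm Q _
        · exact hz
        · exact base_lits ρ _ A hA
        · exact hKb A hA
      · simp only [List.length_cons, List.length_append, List.length_map]
        omega
    have h₀ := son false
    have h₁ := son true
    have e₀ : litForm (v, !false) = var v := rfl
    have e₁ : litForm (v, !true) = neg (var v) := rfl
    rw [e₀] at h₀
    rw [e₁] at h₁
    refine (Sq.cut h₀ h₁).mono ?_
    have h3 : 3 ≤ 2 ^ L₂.length * (B + 3) := by
      calc (3 : ℕ) ≤ 1 * (B + 3) := by omega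
        _ ≤ 2 ^ L₂.length * (B + 3) := Nat.mul_le_mul_right _ Nat.one_le_two_pow
    have e : 2 ^ (L₂.length + 1) * (B + 3) = 2 * (2 ^ L₂.length * (B + 3)) := by ring
    rw [List.length_cons, e]
    omega

/-! ### The row fact -/

/-- **The parity of a row from its canonical clauses.** For a row of kind `κ` with support
`S ⊆ [0,n)` and right-hand side `b`, whose canonical clauses are (negated) in `K` together with
the negated skeleton hypotheses, `⊢ Z(b,n,κ), K` is derivable within
`2^|S| · ((2^(N+2)+3)(n+1) + 2|S| + 5)` ticks. [Buss et al. 1997, Def. 1.1; Beck 2017, Def. 5.6]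
[folklore] -/
theorem sq_row
    (hH3₀ : ∀ k κ, H3 0 k κ = PropForm.biimp (var (zv 0 (k + 1) κ))
      (disj (conj (var (zv 0 k κ)) (neg (Y k κ))) (conj (var (zv 1 k κ)) (Y k κ))))
    (hH3₁ : ∀ k κ, H3 1 k κ = PropForm.biimp (var (zv 1 (k + 1) κ))
      (disj (conj (var (zv 1 k κ)) (neg (Y k κ))) (conj (var (zv 0 k κ)) (Y k κ))))
    (hY : ∀ k κ, Y k κ = var k ∨ Y k κ = const false)
    (hYS : ∀ k, Y k κ = if k ∈ S then var k else const false)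
    (hKb : ∀ A ∈ K, Base Q A) (hQ : 8 ≤ Q.D ∧ 40 ≤ Q.M)
    (hK3 : ∀ (c : ZMod 2) (k : ℕ), k < n → neg (H3 c k κ) ∈ K)
    (hK1 : neg (var (zv 0 0 κ)) ∈ K)
    {N : ℕ} (hN : 1200 ≤ N) (hW : K.length + S.card + N + 10 ≤ Q.W)
    (hSn : ∀ v ∈ S, v < n) {b : ZMod 2}
    (hKcl : ∀ ρ : ℕ → Bool, ((((S.sort (· ≤ ·)).filter fun v => ρ v).length : ℕ) : ZMod 2) ≠ b →
      neg (clauseForm ((S.sort (· ≤ ·)).map fun v => (v, !ρ v))) ∈ K) :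
    Sq Q (2 ^ S.card * ((2 ^ (N + 2) + 3) * (n + 1) + 2 * S.card + 5)) (var (zv b n κ) :: K) := by
  have h := sq_row_merge S K hKb hQ (by omega)
    (sq_row_leaves zv Y H3 κ S n K hH3₀ hH3₁ hY hYS hKb hQ hK3 hK1 hN hW hSn hKcl)
    (S.sort (· ≤ ·)) [] (fun _ => false) (by simp)
  simp only [List.map_nil, List.nil_append, Finset.length_sort] at h
  refine h.mono ?_
  have e : (2 ^ (N + 2) + 3) * (n + 1) + 2 * S.card + 2 + 3 =
      (2 ^ (N + 2) + 3) * (n + 1) + 2 * S.card + 5 := by omega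
  rw [e]
  omega

end Row

end Summit.PneNP.PneNP.Theorems.ModTwo
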